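import Mathlib
import HarnessLib
import HarnessLib.Audit
import Summits.QuantumAdvantage.Statement
import Literature.Computability.QuantumComplexity.CliffordTPathSums
import Literature.Computability.QuantumComplexity.ShallowCircuits
import HarnessLib.Audit.Status.Attr

/-!
Route: PathInvolution

DORMANT since 2026-08-22T20:41:30Z (reconciler: no traction for 5.6 d (last activity item-evidence-added at 2026-08-17T04:35:23Z); parked, not closed — `ledger route dormant route-QuantumAdvantage-PathInvolution --off` to reactivate) — unstaffed, not closed; items shared with open routes are served there. `ledger route dormant <id> --off` reactivates.

# Route QuantumAdvantage/PathInvolution — unitarity as a bijection: the last-disagreement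
involution, the dephasing normal form p = p_deph + (signed crossing pairs), and the
Hadamard-influence budget (idea card unitarity-as-bijection-v2)

## Thesis X (NEGATION side, Dequantize-shaped; expected false, filed so that both sides have typed
objects to shoot at)
Words: every BQP language is decided with gap (2/3, 1/3) by a poly-time-uniform oracle-free
Toffoli+H family {H, X, CNOT, TOF} whose total REACHABLE HADAMARD INFLUENCE is at most 1/10 on every
input — "the interference that sways the output bit is avoidable". Here the dephased (coin-flip)
walk replaces every H by a fair coin (X/CNOT/TOF act classically; as matrices: the product `ust` of
the entrywise-|·|² gate matrices), a Hadamard j on wire w has influence κ_j ≥ ½·|P_deph(accept |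
continue after j from s[w:=0]) − P_deph(accept | … s[w:=1])| maximised over states s such that BOTH
s and s⊕e_w are reachable by the dephased walk from |x 0…0⟩ before gate j, and the budget is Σ_j κ_j
≤ 1/10.
Lean: `PinvTarget` = ∀ L ∈ Literature.Computability.Cryptography.BQP, ∃ F : QCircuitFamily toffoliH,
F.IsOracleFree ∧ F.IsUniform ∧ (gap 2/3,1/3 via F.acceptProbOn 0) ∧ (∀ x, ∃ κ ≥ 0, Σ κ ≤ 1/10 ∧
per-Hadamard reachable-influence bounds) — typed over QGate.toMatrix, QCircuit.acceptEvent,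
padInput, wireEmb (all existing decls; `lean check` rc 0).

## Frame
#0 X = PinvTarget.  #1 Assembly: PinvCriterion → PinvTarget → ¬QuantumAdvantage (pure logic: a
low-influence decider of L ∈ BQP is dequantized by the criterion, so BQP ⊆ BPP, which is literally
¬(∃ L ∈ BQP, L ∉ BPP)).
Given PinvCriterion (low influence ⇒ BPP) and PinvCalibration (BPP ⇒ zero influence), X ⟺ BQP ⊆ BPP
⟺ ¬QuantumAdvantage: the frame is an exact reformulation — "QuantumAdvantage holds iff some BQP
language forces Hadamard influence > 1/10 in every Toffoli+H decider" — and the crux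
PinvShallowInfluence proves exactly that forcing, unconditionally, below logarithmic depth
(Bravyi–Gosset–König's regime, both halves PROVED in the tree).

UNDER FLOOR: fewer than 2 cruxes remain after retriage (legacy route; D-0019).

Rationale: WHY THIS LINE. Transplant of the combinatorialists' sign-reversing-involution principle
(Garsia–Milne) to the tree's Feynman path sums (CliffordTPathSums.lean: pathRun/pathTerm/probAcc,
AdlemanDeMarraisHuang1997): two distinct paths with a common endpoint last disagree at a Hadamard,
and flipping that Hadamard's outcome in both is a sign-reversing involution ι (card Lemma 1; in
print as Amy2019 §3.1 rule [HH]). Consequences we can TYPE NOW over existing decls: (a) bijective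
unitarity/orthogonality (PinvInvolution); (b) the normal form p(x) = p_deph(x) + Σ_{j:H} ½⟨A_j|
X_{w_j} ⊗ D_j |A_j⟩ — interference that matters = output-sensitivity of Hadamard coins along
classical (dephased) trajectories — and Lemma 2: |p − p_deph| ≤ Σ_j κ_j with κ_j the REACHABLE
classical influence of coin j (PinvLayerBoundCT; verified on paper: Cauchy–Schwarz per layer,
Σ_s|A_j(s)|² = 1, A_j(s) ≠ 0 ⇒ s deph-reachable; the reachability refinement is essential, else
coins on fresh ancillas would count); (c) hence a new, cheap, gate-list-level DEQUANTIZATION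
CRITERION (PinvCriterion: budget ≤ 1/10 ⇒ BPP) incomparable with T-count, stabilizer rank, treewidth
(MarkovShi2008), Stahlke2014's multiplicative interference capacity (√2 per H) and Vandennest2011
Cor. 3 (O(log n) non-basis-preserving gates): poly many Hadamards are free when their coins do not
sway the output; (d) a calibration BPP = zero-influence Toffoli+H (PinvCalibration), so X is an
exact reformulation of ¬S; (e) an unconditional S-side shadow: below c·log N depth every Clifford+T
solver of BGK's 2D-HLF problem carries Hadamard influence ≥ δ on some instance
(PinvShallowInfluence; rests on hlf_classical_depth_lower_bound_holds +
hlf_quantum_constant_depth_holds, both proved). Gate sets: the BPP-level statements live over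
`toffoliH` because over Clifford+T the dephased walk is AFFINE (CNOT + coins) — there the criterion
degenerates to "near-affine ⇒ P" and X would be trivially false (AND is not affine); path-level
support and the shallow crux live over `cliffordT`, where the tree has path sums and BGK. Imported
area: bijective combinatorics (involution principle) + Boolean influences; no physical analogy
beyond "dephasing = coin".
RANKED CRUXES. r2 PinvCriterion (new theorem, the load-bearing dequantization step; risk in typing
and in the BPP sampler's conventions). r3 PinvShallowInfluence (interference is unavoidable below
log depth; informative either way: it tests the normal form against the only PROVED advantage
theorem). Target r0 PinvTarget (⟺ ¬S). Support r9: PinvLayerBoundCT (first landing, provable now),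
PinvInvolution (Lemma 1), PinvCalibration (BPP ⊆ zero influence; reversible compilation retargeted
to native Toffoli).
KILL CRITERIA. PinvCriterion refuted as typed (e.g. a low-influence Toffoli+H family deciding a
language outside BPP, or a counterexample to Lemma 2 with the reachability refinement) closes the
route — the mechanism would be wrong, not just weak. PinvTarget refuted = QuantumAdvantage proved
(not expected from here). PinvShallowInfluence refuted would mean the dephased circuit is not a
faithful fan-in-2 classical circuit of the same depth — re-type, not close. Weakness is
acknowledged, not a kill: the criterion cannot certify HH = 1 (the second H has κ = 1/2).
DELIBERATELY NOT DECOMPOSED. (i) The hybrid criterion (dephase only a subset S of Hadamards,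
telescoping bound |p − p_S| ≤ Σ_{j∈S} ‖H E_j H − ½·1⊗(E_j,00 + E_j,11)‖ with E_j the
Heisenberg-evolved acceptance effect, coherent remainder simulated by light cones) — the real
strengthening, to be filed after PinvLayerBoundCT lands. (ii) The card's certificate-complexity
programme (B3/B4: lower bounds for LOCAL sign-reversing involutions on the bent-Forrelation family):
as posed with gate-position windows it is VACUOUS (the window at the last disagreement sees only
diagonal phase gates and layer-3 Hadamards whose flips never reverse sign, while the true cancelling
involution is the Gauss-sum shift on layer-1 bits) — a well-posed complexity measure for cancelling
involutions is an open design question (NOTES.md §Design), not an item. (iii) The relativized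
corollary (the criterion relativizes since oracle gates are monomial; with
exists_oracle_BQPRel_not_subset_BPPRel it gives an oracle world where Hadamard influence > 1/10 is
forced) — one line once PinvCriterion is proved in oracle form. (iv) An `Encodable toffoliH.Op`
instance is missing in the tree; the statements carry `inferInstanceAs (Encodable ToffoliHOp)`
inline (defeq to the canonical instance).
SOURCES: AdlemanDeMarraisHuang1997, Amy2019 (arXiv:1805.06908), Stahlke2014 (arXiv:1305.2186, Def.
5, Thm 8), Vandennest2011 (arXiv:0911.1624, Thm 1, Cor. 3), BravyiGossetKonigScience2018 (Thm 1–2),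
Shi2003, MarkovShi2008, BernsteinVazirani1997 §8, arXiv:quant-ph/0408129 (Dawson et al.),
arXiv:2003.05678 (Vilmart).

Novelty: Nearest prior art (searched 2026-08-15: `lit search --hybrid "dephasing Hadamard gates classical
simulation coherence influence acceptance probability"` (books only: AroraBarak2009 pp 257-8,
NielsenChuang2010), `lit vsearch` of Lemma 2 in prose (no paper hit), `lit galaxy search
"sum-over-paths" --star all` (Amy–Glaudell–Li–Ross Toffoli-Hadamard synthesis; Chareton et al.
survey arXiv:2109.06493), `lit read arXiv:1305.2186` pp 12,14 and `lit read arXiv:0911.1624` pp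
4,10,13; plus the refuter audit of the card: arXiv:1805.06908, arXiv:2003.05678, arXiv:2205.02600,
arXiv:quant-ph/0408129, doi:10.1103/PhysRevD.47.3345): (1) the involution ι is IN PRINT as Amy2019
§3.1 rule [HH] (interference pairing on path sums, normalising C*C = 1) and as Garsia–Milne folklore
— filed as support, no novelty claimed; (2) p = p_deph + off-diagonal = the decoherence-functional
split (Gell-Mann–Hartle; Stahlke2014 §6.4) — known; (3) Stahlke2014 Def. 5/Thm 8: simulation cost
quadratic in the PRODUCT of interference-producing capacities, √2 per Hadamard whatever its role;
Vandennest2011 Cor. 3 / p.10: basis-preserving (Toffoli, CNOT, phases) circuits with k = O(log n)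
non-basis-preserving gates are simulable, and s^m = poly cannot become m = poly unless BQP = BPP.
DELTA: the reachable-influence budget is ADDITIVE and weighs each Hadamard by the classical
output-sensitivity of its coin (zero for coins that never sway the output, however many), giving (a)
a dequantization criterion not in print (refut  [refs: 10.1103/PhysRevD.47.3345, 2109.06493, 1305.2186, 0911.1624, 1805.06908, 2003.05678, 2205.02600, quant-ph/0408129, doi:10.1103/PhysRevD.47.3345, AroraBarak2009, NielsenChuang2010, Amy2019, Stahlke2014, Vandennest2011, BravyiGossetKonigScience2018]

Barriers (technique_class: simulation, dequantization, path-sums, dephasing): technique_class: simulation, dequantization, path-sums, dephasing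
- Literature.Barriers.QuantumAdvantage.Relativization: ENGAGED AND LOCALISED. PinvCriterion
relativizes (an oracle gate is a permutation, hence monomial: the dephased walk just calls the
oracle classically and Lemma 2 goes through verbatim), so relative to the Bernstein–Vazirani/Simon
oracles (tree: exists_oracle_BQPRel_not_subset_BPPRel) the relativized PinvTarget is FALSE; by
`Relativization.not_relativizes_collapse_shape` every proof of PinvTarget must be non-relativizing,
i.e. must use the explicit gate list beyond its oracle-call structure. The route does not claim to
have such a proof; it claims the typed frame + the criterion + the shallow-depth theorem.
- Literature.Barriers.QuantumAdvantage.Algebrization: same verdict as Relativization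
(AaronsonWigderson: BQP = BPP needs non-algebrizing techniques); the criterion is not an
arithmetization and says nothing about PinvTarget.
- Literature.Barriers.QuantumAdvantage.NaturalProofs: not engaged — no circuit lower bound for an
explicit function against P/poly is claimed; PinvShallowInfluence USES the proved BGK NC⁰-type bound
(light cones + the necklace game), far below the natural-proofs regime.
- Literature.Barriers.QuantumAdvantage.SeparationPrerequisites: not engaged — no unconditional class
separation is claimed; the unconditional statement is at depth ≤ c log N where BGK is a theorem.
- Literature.Barriers.QuantumAdvantage.NoiseThresholdUpperBounds (and

History (route lifecycle, newest last):
- 2026-08-16T04:15:08Z · AUTO-CRUX (backfill): PinvTarget — hypotheses of the deciding theorem that nothing in the route derives are cruxes (operator:999:1085951)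
- 2026-08-22T20:41:30Z · DORMANT — reconciler: no traction for 5.6 d (last activity item-evidence-added at 2026-08-17T04:35:23Z); parked, not closed — `ledger route dormant route-QuantumAdvantage (operator:999:3222012)

sub-problem: QuantumAdvantage · status: dormant · opened planner-plancard-QuantumAdvantage-QuantumAdva-c732696e-0 2026-08-15T11:00:17Z · rev 2 · ledger route-QuantumAdvantage-PathInvolution
GENERATED by the gate from the ledger (D-0016/17). Provers cite these decls: `theorem foo : Summit.QuantumAdvantage.QuantumAdvantage.Theses.PathInvolution.<Decl> := …` in Summits/QuantumAdvantage/QuantumAdvantage/Theorems/<Name>.lean.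
-/

namespace Summit.QuantumAdvantage.QuantumAdvantage.Theses.PathInvolution

open scoped BigOperators Topology Manifold Classical MeasureTheory ProbabilityTheory Matrix InnerProductSpace ComplexConjugate ContinuousMap
open Filter Set Function TopologicalSpace MeasureTheory

attribute [summit_statement] _root_.QuantumAdvantage

open Literature.QuantumAdvantage

/-- item stmt-QuantumAdvantage-2012 · crux (kind.auto-crux: conjecture-grade) · rank 0 · open · by planner
why it might fail: Expected FALSE: with PinvCriterion + PinvCalibration it is <-> BQP ⊆ BPP <-> ¬QuantumAdvantage (X restates ¬S); FACTORING ∈ BQP (Shor); relativized form false (exists_oracle_BQPRel_not_subset_BPPRel_holds, BV/Simon) while the criterion relativizes => only non-relativizing proofs; unrefutable today.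
sources: BernsteinVazirani1997, Shi2003, Stahlke2014
THESIS X (negation side; card unitarity-as-bijection-v2). Every BQP language is decided with gap
(2/3,1/3) by a poly-time-uniform oracle-free Toffoli+H family (tree gate set `toffoliH` =
{H,X,CNOT,TOF}) whose total REACHABLE HADAMARD INFLUENCE is <= 1/10 on every input x: `ust L` is the
dephased (coin-flip) Markov chain of a gate list (product of the entrywise-|.|^2, i.e.
unistochastic, gate matrices; H = fair coin, X/CNOT/TOF classical); for each Hadamard j on wire w,
kappa_j >= 1/2 |P_deph(accept | continue after j from s[w:=0]) - P_deph(accept | ... s[w:=1])| over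
all s with BOTH s and s+e_w reachable from |x0..0> before gate j; budget sum_j kappa_j <= 1/10. 'The
interference that sways the output is avoidable.' Given PinvCriterion and PinvCalibration, X <-> BQP
<= BPP <-> not QuantumAdvantage (exact reformulation). Expected FALSE: Shor/FACT in BQP, and its
relativized form is provably false (BV/Simon oracles) while the criterion relativizes, so any proof
is non-relativizing. [BernsteinVazirani1997 §8; Shi2003; Stahlke2014] -/
@[route_item "route-QuantumAdvantage-PathInvolution", crux]
def PinvTarget : Prop :=
  ∀ (ust : {M : ℕ} → List (Literature.Computability.Cryptography.QGate Literature.Computability.Cryptography.toffoliH M) → Matrix (Literature.Computability.Cryptography.QReg M) (Literature.Computability.Cryptography.QReg M) ℝ), (∀ (M : ℕ) (L : List (Literature.Computability.Cryptography.QGate Literature.Computability.Cryptography.toffoliH M)), ust L = (L.map fun g => (g.toMatrix 0).map fun a : ℂ => ‖a‖ ^ 2).reverse.prod) → ∀ L ∈ Literature.Computability.Cryptography.BQP, ∃ F : Literature.Computability.Cryptography.QCircuitFamily Literature.Computability.Cryptography.toffoliH, F.IsOracleFree ∧ @Literature.Computability.Cryptography.QCircuitFamily.IsUniform Literature.Computability.Cryptography.toffoliH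 (inferInstanceAs (Encodable Literature.Computability.Cryptography.ToffoliHOp)) F ∧ (∀ x, (x ∈ L → 2 / 3 ≤ F.acceptProbOn 0 x) ∧ (x ∉ L → F.acceptProbOn 0 x ≤ 1 / 3)) ∧ ∀ x : List Bool, ∃ κ : ℕ → ℝ, (∀ j, 0 ≤ κ j) ∧ (∑ j ∈ Finset.range (F.circ x.length).gates.length, κ j) ≤ 1 / 10 ∧ ∀ (j : ℕ) (hj : j < (F.circ x.length).gates.length) (w : Fin (x.length + F.ancillas x.length)) (s : Literature.Computability.Cryptography.QReg (x.length + F.ancillas x.length)), (F.circ x.length).gates.get ⟨j, hj⟩ = Literature.Computability.Cryptography.QGate.gate Literature.Computability.Cryptography.ToffoliHOp.H (Literature.Computability.QuantumComplexity.wireEmb w) → 0 < ust ((F.circ x.length).gates.take j) s (Literature.Computability.Cryptography.padInput x.get (F.ancillas x.length)) → 0 < ust ((F.circ x.length).gates.take j) (Function.update s w (!s w)) (Literature.Computability.Cryptography.padInput x.get (F.ancillas x.length)) → |(∑ y, if y ∈ Literature.Computability.Cryptography.QCircuit.acceptEvent (x.length + F.ancillas x.length) then ust ((F.circ x.length).gates.drop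 (j + 1)) y (Function.update s w false) else 0) - (∑ y, if y ∈ Literature.Computability.Cryptography.QCircuit.acceptEvent (x.length + F.ancillas x.length) then ust ((F.circ x.length).gates.drop (j + 1)) y (Function.update s w true) else 0)| ≤ 2 * κ j

/-- item stmt-QuantumAdvantage-2014 · crux · rank 2 · open · by planner
why it might fail: Content near-certain (Lemma 2 = BBBV-style hybrid + Cauchy-Schwarz; 4 refuter re-derivations); fails only AS TYPED: `.reverse.prod`/column-stochastic `ust`, take j/drop (j+1) indexing, IsUniform (inline Encodable) -> bp·P coin-walk sampler, re-amplifying the dephased 17/30-13/30 gap (maj3 x3).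
sources: BennettBernsteinBrassardVazirani1997, Stahlke2014, Vandennest2011, Amy2019, AroraBarak2009, AdlemanDeMarraisHuang1997
HADAMARD-INFLUENCE DEQUANTIZATION CRITERION (card Lemma 2 at family level, over `toffoliH`). If a
uniform oracle-free {H,X,CNOT,TOF} family has total reachable Hadamard influence <= 1/10 on every
input (hypothesis spelled exactly as in PinvTarget), every language it decides with gap (2/3,1/3) is
in BPP. Proof plan: (i) normal form p(x) = p_deph(x) + sum_{j:H} 1/2 <A_j| X_{w_j} (x) D_j |A_j> by
grouping off-diagonal coincident PATH PAIRS by their LAST DISAGREEMENT - necessarily a Hadamard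
since X/CNOT/TOF are permutations - and cancelling within orbits of the last-disagreement flip
(PinvInvolution; Amy2019 rule [HH]); A_j = state before gate j, D_j(s) = difference of dephased
acceptance probabilities after forcing coin j to 0/1; (ii) 2|A_j(s)A_j(s+e_w)| <=
|A_j(s)|^2+|A_j(s+e_w)|^2, sum_s |A_j(s)|^2 = 1 and (A_j(s) != 0 => s deph-reachable) give |p -
p_deph| <= sum_j kappa_j <= 1/10 (cf. PinvLayerBoundCT for the Clifford+T path-sum form); (iii)
p_deph is the acceptance probability of the randomized CLASSICAL circuit 'H -> fair coin', sampled
by a PTM from the uniform description: p >= 2/3 => p_deph >= 17/30, p <= 1/3 => p_deph <= 13/30;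
amplify. Stated over Toffoli+H because over Cl -/
@[route_item "route-QuantumAdvantage-PathInvolution", crux]
def PinvCriterion : Prop :=
  ∀ (ust : {M : ℕ} → List (Literature.Computability.Cryptography.QGate Literature.Computability.Cryptography.toffoliH M) → Matrix (Literature.Computability.Cryptography.QReg M) (Literature.Computability.Cryptography.QReg M) ℝ), (∀ (M : ℕ) (L : List (Literature.Computability.Cryptography.QGate Literature.Computability.Cryptography.toffoliH M)), ust L = (L.map fun g => (g.toMatrix 0).map fun a : ℂ => ‖a‖ ^ 2).reverse.prod) → ∀ F : Literature.Computability.Cryptography.QCircuitFamily Literature.Computability.Cryptography.toffoliH, F.IsOracleFree → @Literature.Computability.Cryptography.QCircuitFamily.IsUniform Literature.Computability.Cryptography.toffoliH (inferInstanceAs (Encodable Literature.Computability.Cryptography.ToffoliHOp)) F → (∀ x : List Bool, ∃ κ : ℕ → ℝ, (∀ j, 0 ≤ κ j) ∧ (∑ j ∈ Finset.range (F.circ x.length).gates.length, κ j) ≤ 1 / 10 ∧ ∀ (j : ℕ) (hj : j < (F.circ x.length).gates.length) (w : Fin (x.length + F.ancillas x.length)) (s : Literature.Computability.Cryptography.QReg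 (x.length + F.ancillas x.length)), (F.circ x.length).gates.get ⟨j, hj⟩ = Literature.Computability.Cryptography.QGate.gate Literature.Computability.Cryptography.ToffoliHOp.H (Literature.Computability.QuantumComplexity.wireEmb w) → 0 < ust ((F.circ x.length).gates.take j) s (Literature.Computability.Cryptography.padInput x.get (F.ancillas x.length)) → 0 < ust ((F.circ x.length).gates.take j) (Function.update s w (!s w)) (Literature.Computability.Cryptography.padInput x.get (F.ancillas x.length)) → |(∑ y, if y ∈ Literature.Computability.Cryptography.QCircuit.acceptEvent (x.length + F.ancillas x.length) then ust ((F.circ x.length).gates.drop (j + 1)) y (Function.update s w false) else 0) - (∑ y, if y ∈ Literature.Computability.Cryptography.QCircuit.acceptEvent (x.length + F.ancillas x.length) then ust ((F.circ x.length).gates.drop (j + 1)) y (Function.update s w true) else 0)| ≤ 2 * κ j) → ∀ L : Language Bool, (∀ x, (x ∈ L → 2 / 3 ≤ F.acceptProbOn 0 x) ∧ (x ∉ L → F.acceptProbOn 0 x ≤ 1 / 3)) → L ∈ Literature.Computability.Complexity.BPP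

/-- item stmt-QuantumAdvantage-2015 · support · rank 3 · open · by planner
why it might fail: No independent failure mode: event form of Lemma 2 (same proof as PinvLayerBoundCT) + the PROVED hlf_classical_depth_lower_bound_holds (c=1/2, N0=2^30; take c:=1/4); residual risk is bookkeeping (B2-Circuit translation depth +O(1), outputPMF_apply/toReal).
sources: BravyiGossetKonigScience2018, Stahlke2014, AdlemanDeMarraisHuang1997
INTERFERENCE IS UNAVOIDABLE BELOW LOG DEPTH - the S-side shadow of the thesis in the one regime
where quantum advantage is a THEOREM (Bravyi-Gosset-Konig; both halves PROVED in the tree: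
hlf_quantum_constant_depth_holds, hlf_classical_depth_lower_bound_holds with c = 1/2, N0 = 2^30).
There are c > 0 and N0 such that for N >= N0 and every delta > 0: an oracle-free Clifford+T circuit
C of depth <= c log N on inLen N + m wires, with injective output wires `out`, that outputs an
element of hlfSolutions I with probability >= 7/8 + delta on EVERY valid 2D-HLF instance I, has on
SOME valid instance I total reachable Hadamard influence >= delta with respect to the success event
{y : y o out in hlfSolutions I} (every admissible profile kappa >= 0 - dominating half the dephased
output-sensitivity of each Hadamard over reachable pairs s, s+e_w - sums to >= delta). Proof plan:
event form of Lemma 2 (same proof as PinvLayerBoundCT) + the dephased Clifford+T gate list IS a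
classical probabilistic circuit of fan-in <= 2 and depth <= depth(C)+1 over the input bits and
hCount(C) coins (H -> fresh coin, CNOT -> XOR, S/T -> wire, ancilla zeros as constants) + BGK's
classical bound => some valid insta -/
@[route_item "route-QuantumAdvantage-PathInvolution"]
def PinvShallowInfluence : Prop :=
  ∃ c : ℝ, 0 < c ∧ ∃ N₀ : ℕ, ∀ N ≥ N₀, ∀ (δ : ℝ), 0 < δ → ∀ (m : ℕ) (C : Literature.Computability.Cryptography.QCircuit Literature.Computability.Cryptography.cliffordT (Literature.Computability.QuantumComplexity.inLen N + m)) (out : Fin N × Fin N → Fin (Literature.Computability.QuantumComplexity.inLen N + m)), Function.Injective out → C.IsOracleFree → (C.depth : ℝ) ≤ c * Real.log N → (∀ I : Literature.Computability.QuantumComplexity.HLFInstance N, I.IsValid → 7 / 8 + δ ≤ ((C.outputPMF 0 (Literature.Computability.QuantumComplexity.encodeHLF I)).toOuterMeasure {y | (fun v => y (out v)) ∈ Literature.Computability.QuantumComplexity.hlfSolutions I}).toReal) → ∃ I : Literature.Computability.QuantumComplexity.HLFInstance N, I.IsValid ∧ ∀ (dAcc : List (Literature.Computability.Cryptography.QGate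 Literature.Computability.Cryptography.cliffordT (Literature.Computability.QuantumComplexity.inLen N + m)) → Literature.Computability.Cryptography.QReg (Literature.Computability.QuantumComplexity.inLen N + m) → ℝ), (∀ L s, dAcc L s = ((Finset.univ.filter fun b : Fin L.length → Bool => ∃ z φ, Literature.Computability.QuantumComplexity.pathRun L s (List.ofFn b) = some (z, φ) ∧ (fun v => z (out v)) ∈ Literature.Computability.QuantumComplexity.hlfSolutions I).card : ℝ) / 2 ^ Literature.Computability.QuantumComplexity.hCount L) → ∀ κ : ℕ → ℝ, (∀ j, 0 ≤ κ j) → (∀ (j : ℕ) (hj : j < C.gates.length) (e : Fin (Literature.Computability.Cryptography.cliffordT.arity Literature.Computability.Cryptography.CliffordTOp.H) ↪ Fin (Literature.Computability.QuantumComplexity.inLen N + m)) (s : Literature.Computability.Cryptography.QReg (Literature.Computability.QuantumComplexity.inLen N + m)), C.gates.get ⟨j, hj⟩ = Literature.Computability.Cryptography.QGate.gate Literature.Computability.Cryptography.CliffordTOp.H e → (∃ (b : Fin (C.gates.take j).length → Bool) (φ : ℕ), Literature.Computability.QuantumComplexity.pathRun (C.gates.take j) (Literature.Computability.Cryptography.padInput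 (Literature.Computability.QuantumComplexity.encodeHLF I) m) (List.ofFn b) = some (s, φ)) → (∃ (b : Fin (C.gates.take j).length → Bool) (φ : ℕ), Literature.Computability.QuantumComplexity.pathRun (C.gates.take j) (Literature.Computability.Cryptography.padInput (Literature.Computability.QuantumComplexity.encodeHLF I) m) (List.ofFn b) = some (Function.update s (Literature.Computability.QuantumComplexity.embH e 0) (!s (Literature.Computability.QuantumComplexity.embH e 0)), φ)) → |dAcc (C.gates.drop (j + 1)) (Function.update s (Literature.Computability.QuantumComplexity.embH e 0) false) - dAcc (C.gates.drop (j + 1)) (Function.update s (Literature.Computability.QuantumComplexity.embH e 0) true)| ≤ 2 * κ j) → δ ≤ ∑ j ∈ Finset.range C.gates.length, κ j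

/-- item stmt-QuantumAdvantage-2016 · support · rank 9 · open · by planner
sources: AdlemanDeMarraisHuang1997, Amy2019, Stahlke2014
LEMMA 2 over the tree's Clifford+T path sums (provable NOW from CliffordTPathSums.lean: pathRun,
hCount, probAcc, prodZeta_mulVec_basisState, normSq_prodZeta_mulVec_basisState). dAcc L s = (# coin
strings b valid for L whose classical trajectory from s ends with wire 0 = 1) / 2^{hCount L} is the
dephased acceptance probability (valid = choice bit 0 at S/T/CNOT, free at H; there are exactly
2^{hCount} valid strings). For every profile kappa >= 0 with 2 kappa_j >= |dAcc(gs after j, s[w:=0])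
- dAcc(gs after j, s[w:=1])| for each Hadamard j (wire w = embH e 0) and each s such that s and
s+e_w are both endpoints of valid path prefixes from s0: |probAcc omega gs s0 - dAcc gs s0| <=
sum_{j < |gs|} kappa_j. Proof: write 2^h p = sum over coincident accepted path pairs of
omega^{phi-phi'} (two_pow_mul_normSq_amp_omega), diagonal pairs give 2^h dAcc, off-diagonal pairs
grouped by last disagreement j give sum_s A_j(s) conj A_j(s+e_w) (-1)^c-weighted suffix counts = 1/2
<A_j|X_w D_j|A_j> (PinvInvolution's sign analysis), then Cauchy-Schwarz with sum_s |A_j(s)|^2 = 1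
and support(A_j) within reachable states. First landing of the route; numerically checked by the
ideator on random circuits (n <= -/
@[route_item "route-QuantumAdvantage-PathInvolution"]
def PinvLayerBoundCT : Prop :=
  ∀ (M : ℕ) (hM : 0 < M) (dAcc : List (Literature.Computability.Cryptography.QGate Literature.Computability.Cryptography.cliffordT M) → Literature.Computability.Cryptography.QReg M → ℝ), (∀ L s, dAcc L s = ((Finset.univ.filter fun b : Fin L.length → Bool => ∃ z φ, Literature.Computability.QuantumComplexity.pathRun L s (List.ofFn b) = some (z, φ) ∧ z ⟨0, hM⟩ = true).card : ℝ) / 2 ^ Literature.Computability.QuantumComplexity.hCount L) → ∀ (gs : List (Literature.Computability.Cryptography.QGate Literature.Computability.Cryptography.cliffordT M)), (∀ g ∈ gs, g.IsOracleFree) → ∀ (s₀ : Literature.Computability.Cryptography.QReg M) (κ : ℕ → ℝ), (∀ j, 0 ≤ κ j) → (∀ (j : ℕ) (hj : j < gs.length) (e : Fin (Literature.Computability.Cryptography.cliffordT.arity Literature.Computability.Cryptography.CliffordTOp.H) ↪ Fin M) (s : Literature.Computability.Cryptography.QReg M), gs.get ⟨j, hj⟩ = Literature.Computability.Cryptography.QGate.gate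 Literature.Computability.Cryptography.CliffordTOp.H e → (∃ (b : Fin (gs.take j).length → Bool) (φ : ℕ), Literature.Computability.QuantumComplexity.pathRun (gs.take j) s₀ (List.ofFn b) = some (s, φ)) → (∃ (b : Fin (gs.take j).length → Bool) (φ : ℕ), Literature.Computability.QuantumComplexity.pathRun (gs.take j) s₀ (List.ofFn b) = some (Function.update s (Literature.Computability.QuantumComplexity.embH e 0) (!s (Literature.Computability.QuantumComplexity.embH e 0)), φ)) → |dAcc (gs.drop (j + 1)) (Function.update s (Literature.Computability.QuantumComplexity.embH e 0) false) - dAcc (gs.drop (j + 1)) (Function.update s (Literature.Computability.QuantumComplexity.embH e 0) true)| ≤ 2 * κ j) → |Literature.Computability.QuantumComplexity.probAcc Literature.Computability.QuantumComplexity.omega gs s₀ hM - dAcc gs s₀| ≤ ∑ j ∈ Finset.range gs.length, κ j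

/-- item stmt-QuantumAdvantage-2017 · support · rank 9 · open · by planner
sources: Amy2019, AdlemanDeMarraisHuang1997
LEMMA 1, 'unitarity is a bijection' (card; the mechanism is IN PRINT - Amy2019 §3.1 rule [HH] / the
Garsia-Milne involution principle - filed as reusable infrastructure, no novelty claimed). For an
oracle-free Clifford+T gate list gs and inputs w, w' there is an involution iota on pairs of choice
strings, fixing the diagonal when w = w', that NEGATES the pair weight T(p) = sum_z pathTerm omega
gs w z p.1 * conj(pathTerm omega gs w' z p.2) on every pair with w != w' or p.1 != p.2: on
coincident valid pairs iota flips, in BOTH paths, the outcome bit of the Hadamard at their LAST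
DISAGREEMENT (the two states before it differ exactly in its wire; prefix phases untouched, suffix
phases common, the H-phase ratio (-1)^{b+b''} flips sign); on pairs with T(p) = 0 it is the
identity. Corollaries (Finset.sum_involution): sum_z |<z|U|w>|^2 = 1 and <Uw|Uw'> = 0 without
matrices, and the normal form behind PinvLayerBoundCT. [Amy2019 §3.1; AdlemanDeMarraisHuang1997 §6
Lemma 6.10 (path pairs)] -/
@[route_item "route-QuantumAdvantage-PathInvolution"]
def PinvInvolution : Prop :=
  ∀ (N : ℕ) (gs : List (Literature.Computability.Cryptography.QGate Literature.Computability.Cryptography.cliffordT N)), (∀ g ∈ gs, g.IsOracleFree) → ∀ (w w' : Literature.Computability.Cryptography.QReg N), ∃ ι : (Fin gs.length → Bool) × (Fin gs.length → Bool) → (Fin gs.length → Bool) × (Fin gs.length → Bool), Function.Involutive ι ∧ (w = w' → ∀ b, ι (b, b) = (b, b)) ∧ ∀ p, (w ≠ w' ∨ p.1 ≠ p.2) → (∑ z, Literature.Computability.QuantumComplexity.pathTerm Literature.Computability.QuantumComplexity.omega gs w z (List.ofFn (ι p).1) * star (Literature.Computability.QuantumComplexity.pathTerm Literature.Computability.QuantumComplexity.omega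 gs w' z (List.ofFn (ι p).2))) = -(∑ z, Literature.Computability.QuantumComplexity.pathTerm Literature.Computability.QuantumComplexity.omega gs w z (List.ofFn p.1) * star (Literature.Computability.QuantumComplexity.pathTerm Literature.Computability.QuantumComplexity.omega gs w' z (List.ofFn p.2)))

/-- item stmt-QuantumAdvantage-2018 · support · rank 9 · open · by planner
sources: BernsteinVazirani1997, Shi2003
CALIBRATION: BPP <= ZERO-influence Toffoli+H. Every BPP language is decided (gap 2/3,1/3) by a
uniform oracle-free {H,X,CNOT,TOF} family in which every Hadamard acts on a classically determined
wire: before each H (gate j, wire w) no pair s, s+e_w is simultaneously reachable by the dephased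
chain `ust` from |x0..0> (hence every kappa_j = 0 and p = p_deph exactly). Proof plan: BPP = bp.P;
compile the deterministic poly-time predicate M(x,r) into a uniform reversible X/CNOT/TOF circuit
(Bennett; retarget the reversible compiler behind P_subset_BQP_holds / ReversibleCliffordT.lean from
Clifford+T to native Toffoli, which only simplifies it), supply r by H gates applied ONCE to fresh
|0> ancillas at the start, swap the answer onto wire 0, keep >= 1 ancilla so that n = 0 is handled.
With PinvCriterion: BPP = {languages of uniform Toffoli+H families of reachable influence 0} = {...
<= 1/10} - 'BPP is the influence-free part of BQP' - so PinvTarget <-> BQP <= BPP and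
QuantumAdvantage <-> some BQP language forces influence > 1/10 in every Toffoli+H decider. Same
inline Encodable instance as PinvCriterion. [BernsteinVazirani1997 §8; Shi2003; AroraBarak Def 7.3] -/
@[route_item "route-QuantumAdvantage-PathInvolution"]
def PinvCalibration : Prop :=
  ∀ (ust : {M : ℕ} → List (Literature.Computability.Cryptography.QGate Literature.Computability.Cryptography.toffoliH M) → Matrix (Literature.Computability.Cryptography.QReg M) (Literature.Computability.Cryptography.QReg M) ℝ), (∀ (M : ℕ) (L : List (Literature.Computability.Cryptography.QGate Literature.Computability.Cryptography.toffoliH M)), ust L = (L.map fun g => (g.toMatrix 0).map fun a : ℂ => ‖a‖ ^ 2).reverse.prod) → ∀ L ∈ Literature.Computability.Complexity.BPP, ∃ F : Literature.Computability.Cryptography.QCircuitFamily Literature.Computability.Cryptography.toffoliH, F.IsOracleFree ∧ @Literature.Computability.Cryptography.QCircuitFamily.IsUniform Literature.Computability.Cryptography.toffoliH (inferInstanceAs (Encodable Literature.Computability.Cryptography.ToffoliHOp)) F ∧ (∀ x, (x ∈ L → 2 / 3 ≤ F.acceptProbOn 0 x) ∧ (x ∉ L → F.acceptProbOn 0 x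 ≤ 1 / 3)) ∧ ∀ (x : List Bool) (j : ℕ) (hj : j < (F.circ x.length).gates.length) (w : Fin (x.length + F.ancillas x.length)) (s : Literature.Computability.Cryptography.QReg (x.length + F.ancillas x.length)), (F.circ x.length).gates.get ⟨j, hj⟩ = Literature.Computability.Cryptography.QGate.gate Literature.Computability.Cryptography.ToffoliHOp.H (Literature.Computability.QuantumComplexity.wireEmb w) → ust ((F.circ x.length).gates.take j) s (Literature.Computability.Cryptography.padInput x.get (F.ancillas x.length)) = 0 ∨ ust ((F.circ x.length).gates.take j) (Function.update s w (!s w)) (Literature.Computability.Cryptography.padInput x.get (F.ancillas x.length)) = 0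

/-- item stmt-QuantumAdvantage-2013 · assembly · rank 1 · open · by planner
sources: BernsteinVazirani1997
Pure logic: from hT obtain a low-influence uniform Toffoli+H decider F of any L in BQP (instantiate
ust := the unistochastic chain, characterising hypothesis by rfl), hC puts L in BPP, contradicting L
not in BPP. Checked in the planner's Sketch.lean (example closes by `intro/obtain/exact`). -/
@[route_item "route-QuantumAdvantage-PathInvolution"]
def Assembly : Prop :=
  PinvCriterion → PinvTarget → ¬ QuantumAdvantage

/-! D-0027 §2.1 — DECIDING THEOREM (planner-authored via `route open/edit --closes-file`; by planner-rbadge-QuantumAdvantage-PathInvolution-08b75c18-g2-0 2026-08-15T16:16:49Z):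
its hypotheses are this route's items and its conclusion the sub-problem Statement (glue_lint), and it elaborates with this file. -/

@[closes "route-QuantumAdvantage-PathInvolution"] theorem closes (hC : PinvCriterion) (hT : PinvTarget) : ¬ _root_.QuantumAdvantage := by
  rintro ⟨L, hLBQP, hLBPP⟩
  obtain ⟨F, hOF, hU, hgap, hκ⟩ :=
    hT (fun {M} gs => (gs.map fun g => (g.toMatrix 0).map fun a : ℂ => ‖a‖ ^ 2).reverse.prod)
      (fun _ _ => rfl) L hLBQP
  exact hLBPP
    (hC (fun {M} gs => (gs.map fun g => (g.toMatrix 0).map fun a : ℂ => ‖a‖ ^ 2).reverse.prod)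
      (fun _ _ => rfl) F hOF hU hκ L hgap)

end Summit.QuantumAdvantage.QuantumAdvantage.Theses.PathInvolution
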